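import Summits.QuantumFields.YangMills.Theorems.LangevinControlUVOSLegsFromFemtoAndGapStubLowerTwoPoint

/-!
# Stub `stub_lower` of line `dlr-collar-transfer` (crux `OSLegsFromFemtoAndGap`, stmt-QuantumFields-9367):
# the two-point half of `LowerBounds`

`lowerBounds_twoPoint`: `(∀ β, 0 < a β) → a → 0 → FBL → FC2 → (LowerBounds G r a).1`, i.e. a real
positive-time bump `v` and `ε > 0` with `Q2(θv, v) ≥ ε` on every large torus at every large coupling.
Scale selection inside the growth clauses of FC2, the per-pair floor `pair_floor`, positivity of the
bump weights, and the Riemann mass of the two plateaux (`pow_le_sum_box`).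
-/

set_option autoImplicit false

noncomputable section

open scoped SchwartzMap
open MeasureTheory Filter Topology Metric
open Literature.MathematicalPhysics.QuantumFieldTheory Literature.MathematicalPhysics.QuantumLattice
open Literature.MathematicalPhysics.AQFT Literature.Probability.LatticeModels
open Summit.QuantumFields.YangMills.Theorems.OSLegsFromFemtoAndGap.StubLower

namespace Summit.QuantumFields.YangMills.Cruxes.OSLegsFromFemtoAndGap.DlrCollarTransfer.StubLower

/-! ### Bumps read through the time reflection -/

/-- `‖θ z - p₀‖ = ‖z + p₀‖` for `p₀ = (s/2) e₀`. [folklore] -/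
theorem norm_timeReflection_sub_single (z : EuclideanSpace ℝ (Fin 4)) (t : ℝ) :
    ‖timeReflection 4 z - EuclideanSpace.single 0 t‖ = ‖z + EuclideanSpace.single 0 t‖ := by
  have h : timeReflection 4 z - EuclideanSpace.single 0 t =
      timeReflection 4 (z + EuclideanSpace.single 0 t) := by
    rw [map_add, timeReflection_single_zero]; abel
  rw [h, LinearIsometryEquiv.norm_map]

/-- A weighted double sum with non-negative weights dominates `κ · (Σf)(Σg)` as soon as `κ ≤ C x y`
on the pairs that are actually weighted. [folklore] -/
theorem mul_sum_mul_sum_le {B : Finset (Fin 4 → ℤ)} {f g : (Fin 4 → ℤ) → ℝ}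
    {C : (Fin 4 → ℤ) → (Fin 4 → ℤ) → ℝ} {κ : ℝ} (hf : ∀ x, 0 ≤ f x) (hg : ∀ y, 0 ≤ g y)
    (hC : ∀ x y, f x ≠ 0 → g y ≠ 0 → κ ≤ C x y) :
    κ * ((∑ x ∈ B, f x) * (∑ y ∈ B, g y)) ≤ ∑ x ∈ B, ∑ y ∈ B, f x * g y * C x y := by
  rw [Finset.sum_mul_sum, Finset.mul_sum]
  refine Finset.sum_le_sum fun x _ => ?_
  rw [Finset.mul_sum]
  refine Finset.sum_le_sum fun y _ => ?_
  by_cases hx : f x = 0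
  · simp [hx]
  by_cases hy : g y = 0
  · simp [hy]
  have := hC x y hx hy
  have hfg : 0 ≤ f x * g y := mul_nonneg (hf x) (hg y)
  nlinarith

/-- Constants bookkeeping for the two-point scale: with `ℓ = min ℓ₁ ℓ₂`, `D = ℓ/100`, `s ≤ ℓ/100`,
`s K(s/2) < 2ℓ/100`, `α ≤ ℓ/100` the cube is femto and fits in every torus with `ℓ ≤ α L`. [folklore] -/
theorem femto_budget {ℓ ℓ₁ ℓ₂ s k α : ℝ} {L : ℕ} (hℓ₁ : ℓ ≤ ℓ₁) (hℓ₂ : ℓ ≤ ℓ₂)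
    (hs : s ≤ ℓ / 100) (hs0 : 0 < s) (hk : s * k < 2 * ℓ / 100) (hα : α ≤ ℓ / 100)
    (hL : ℓ ≤ α * L) :
    3 * s * k + 2 * (ℓ / 100) + 3 * s + 7 * α ≤ ℓ₁ ∧ 3 * s * k + 2 * (ℓ / 100) + 3 * s + 7 * α ≤ ℓ₂ ∧
      3 * s * k / 2 + ℓ / 100 + 3 * s / 2 + 4 * α ≤ α * L := by
  refine ⟨by nlinarith, by nlinarith, by nlinarith⟩

section TwoPoint

variable (G : Type) [Group G] [TopologicalSpace G] [IsTopologicalGroup G] [CompactSpace G]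
  [MeasurableSpace G] [BorelSpace G] (r : LatticeRep G) (a : ℝ → ℝ)

/-- **The two-point half of `LowerBounds`.** [folklore] -/
theorem lowerBounds_twoPoint (hapos : ∀ β, 0 < a β) (hlim : Tendsto a atTop (𝓝 0))
    (hFBL : FBL G r a) (hFC2 : FC2 G r a) :
    ∃ (v : 𝓢(EuclideanSpace ℝ (Fin 4), ℝ)) (ε β₅ Λ₅ : ℝ),
      tsupport v ⊆ {y : EuclideanSpace ℝ (Fin 4) | 0 < y 0} ∧ 0 < ε ∧
      ∀ β : ℝ, β₅ ≤ β → ∀ L : ℕ, Λ₅ ≤ a β * L → ε ≤ Q2 G r β L (a β) (thetaTest 4 v) v := by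
  obtain ⟨C₁, β₁, ℓ₁, p, hℓ₁, hC₁, hFBLc⟩ := hFBL
  obtain ⟨Γ, β₂, ℓ₂, c₂, C₂, K, n₀, hℓ₂, hc₂, hK1, hKlim, hn₀, -, -, hΓlim, hFC2c⟩ := hFC2
  -- the constants
  obtain ⟨ℓ, hℓ⟩ : ∃ ℓ : ℝ, ℓ = min ℓ₁ ℓ₂ := ⟨_, rfl⟩
  have hℓ0 : 0 < ℓ := by rw [hℓ]; exact lt_min hℓ₁ hℓ₂
  have hℓℓ₁ : ℓ ≤ ℓ₁ := hℓ ▸ min_le_left _ _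
  have hℓℓ₂ : ℓ ≤ ℓ₂ := hℓ ▸ min_le_right _ _
  obtain ⟨D, hD⟩ : ∃ D : ℝ, D = ℓ / 100 := ⟨_, rfl⟩
  have hD0 : 0 < D := by rw [hD]; positivity
  obtain ⟨M, hM⟩ : ∃ M : ℝ, M = 8 * C₁ ^ 2 / (c₂ * D ^ 8) + 1 := ⟨_, rfl⟩
  have hM0 : 0 < M := by rw [hM]; positivity
  have hMC : 4 * C₁ ^ 2 / D ^ 8 ≤ c₂ * M / 2 := by
    have : c₂ * M / 2 = 4 * C₁ ^ 2 / D ^ 8 + c₂ / 2 := by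
      rw [hM]; field_simp; ring
    rw [this]; linarith
  obtain ⟨δ₁, hδ₁, hKδ⟩ := exists_delta_of_tendsto_mul hKlim (ε := ℓ / 100) (by positivity)
  obtain ⟨δ₂, hδ₂, hΓδ⟩ := exists_delta_of_tendsto_div_atTop hΓlim M
  obtain ⟨s, hs⟩ : ∃ s : ℝ, s = min (min δ₁ (δ₂ / 2)) (ℓ / 100) := ⟨_, rfl⟩
  have hs0 : 0 < s := by rw [hs]; positivity
  have hsδ₁ : s ≤ δ₁ := by rw [hs]; exact (min_le_left _ _).trans (min_le_left _ _)
  have hsδ₂ : 3 * s / 2 < δ₂ := by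
    have : s ≤ δ₂ / 2 := by rw [hs]; exact (min_le_left _ _).trans (min_le_right _ _)
    linarith
  have hsℓ : s ≤ ℓ / 100 := by rw [hs]; exact min_le_right _ _
  have hsK : s * K (s / 2) < 2 * ℓ / 100 := by
    have := hKδ (s / 2) (by positivity) (by linarith)
    linarith
  -- the bump at height `s/2`, plateau radius `s/8`, support radius `s/4`
  obtain ⟨v, hv0, -, hvone, hvsupp, hvts⟩ :=
    exists_bump_schwartz (EuclideanSpace.single 0 (s / 2)) (ρ := s / 8) (by positivity)
  -- small spacings
  have hn₀0 : (0 : ℝ) < n₀ := by exact_mod_cast hn₀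
  obtain ⟨β₀, hβ₀⟩ := exists_of_tendsto_atTop_nhds_zero hlim
    (a₀ := min (ℓ / 100) (min (s / (2 * n₀)) (s / 16))) (by positivity)
  refine ⟨v, c₂ * M / 2 * (s / 16) ^ 8, max β₀ (max β₁ β₂), ℓ, ?_, by positivity, ?_⟩
  · -- positive time
    rw [hvts]
    intro y hy
    rw [mem_closedBall, dist_eq_norm] at hy
    have h1 := abs_apply_le_norm (y - EuclideanSpace.single 0 (s / 2)) 0
    have h2 : |y 0 - s / 2| ≤ 2 * (s / 8) := by simpa using h1.trans hy
    show 0 < y 0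
    have := (abs_le.1 h2).1
    linarith
  intro β hβ L hL
  have hββ₀ : β₀ ≤ β := le_of_max_le_left hβ
  have hββ₁ : β₁ ≤ β := le_of_max_le_left (le_of_max_le_right hβ)
  have hββ₂ : β₂ ≤ β := le_of_max_le_right (le_of_max_le_right hβ)
  have hα := hapos β
  have hαa₀ := hβ₀ β hββ₀
  have hαℓ : a β ≤ ℓ / 100 := (hαa₀.trans_le (min_le_left _ _)).le
  have hαn : a β ≤ s / (2 * n₀) := (hαa₀.trans_le ((min_le_right _ _).trans (min_le_left _ _))).le
  have hα16 : a β ≤ s / 16 := (hαa₀.trans_le ((min_le_right _ _).trans (min_le_right _ _))).le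
  have hαn₀ : (n₀ : ℝ) * a β ≤ s / 2 := by
    rw [le_div_iff₀ (by positivity)] at hαn; linarith
  obtain ⟨hfem₁, hfem₂, hL'⟩ :=
    femto_budget (L := L) hℓℓ₁ hℓℓ₂ hsℓ hs0 hsK hαℓ hL
  rw [← hD] at hfem₁ hfem₂ hL'
  -- the per-pair floor
  have key : ∀ x y : Fin 4 → ℤ, thetaTest 4 v (a β • siteToE x) ≠ 0 → v (a β • siteToE y) ≠ 0 →
      c₂ * M / 2 * a β ^ 8 ≤ torusE G r β L (fun U => dens G r x U * dens G r y U)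
        - torusE G r β L (dens G r x) * torusE G r β L (dens G r y) := by
    intro x y hx hy
    refine pair_floor G r a hC₁ hFBLc hc₂ hK1 hFC2c hs0 hD0 hΓδ hsδ₂ hMC hββ₁ hββ₂ hα hαn₀
      hfem₁ hfem₂ hL' x y ?_ ?_
    · rw [thetaTest_apply] at hx
      have := hvsupp _ hx
      rw [dist_eq_norm, norm_timeReflection_sub_single] at this
      linarith
    · have := hvsupp _ hy
      rw [dist_eq_norm] at this
      linarith
  -- Riemann mass of the two plateaux
  have hcover : ∀ j, |(EuclideanSpace.single (0 : Fin 4) (s / 2) : EuclideanSpace ℝ (Fin 4)) j|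
      + s / 8 ≤ a β * L := fun j => by
    have : |(EuclideanSpace.single (0 : Fin 4) (s / 2) : EuclideanSpace ℝ (Fin 4)) j| ≤ s / 2 := by
      rw [PiLp.single_apply]
      split_ifs
      · rw [abs_of_pos (by positivity)]
      · rw [abs_zero]; positivity
    nlinarith
  have hSy : (s / 8 / (2 * a β)) ^ 4 ≤ ∑ y ∈ box 4 L, v (a β • siteToE y) :=
    pow_le_sum_box hv0 hα (fun z hz => hvone z hz) (by linarith) hcover
  have hSx : (s / 8 / (2 * a β)) ^ 4 ≤ ∑ x ∈ box 4 L, thetaTest 4 v (a β • siteToE x) := by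
    refine pow_le_sum_box (p := -EuclideanSpace.single 0 (s / 2)) (fun z => ?_) hα
      (fun z hz => ?_) (by linarith) (fun j => by simpa using hcover j)
    · rw [thetaTest_apply]; exact hv0 _
    · rw [thetaTest_apply]
      refine hvone _ ?_
      rwa [dist_eq_norm, norm_timeReflection_sub_single, ← sub_neg_eq_add, ← dist_eq_norm]
  -- summation
  have hsum := mul_sum_mul_sum_le (B := box 4 L) (κ := c₂ * M / 2 * a β ^ 8)
    (f := fun x => thetaTest 4 v (a β • siteToE x)) (g := fun y => v (a β • siteToE y))
    (C := fun x y => torusE G r β L (fun U => dens G r x U * dens G r y U)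
      - torusE G r β L (dens G r x) * torusE G r β L (dens G r y))
    (fun x => by rw [thetaTest_apply]; exact hv0 _) (fun y => hv0 _) key
  unfold Q2
  refine le_trans ?_ hsum
  have hα0 : a β ≠ 0 := hα.ne'
  calc c₂ * M / 2 * (s / 16) ^ 8
      = c₂ * M / 2 * a β ^ 8 * ((s / 8 / (2 * a β)) ^ 4 * (s / 8 / (2 * a β)) ^ 4) := by
        field_simp; ring
    _ ≤ _ := mul_le_mul_of_nonneg_left (mul_le_mul hSx hSy (by positivity)
        ((by positivity : (0 : ℝ) ≤ (s / 8 / (2 * a β)) ^ 4).trans hSx)) (by positivity)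

end TwoPoint

end Summit.QuantumFields.YangMills.Cruxes.OSLegsFromFemtoAndGap.DlrCollarTransfer.StubLower

end
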